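import Summits.QuantumFields.BalabanUV.T4Continuum.Support.NE7EffectiveFormGaugeFixedCoercive
import Summits.QuantumFields.BalabanUV.T4Continuum.Support.NE7BoxPoincareMatrix
import HarnessLib

/-!
# NE7EffectiveFormFlatSpectralGap — THE GAUGE-FIXED `(j+1)`-STEP EFFECTIVE QUADRATIC FORM AT THE FLAT BACKGROUND HAS A SPECTRAL GAP ON MEAN-ZERO FIELDS:
# `Σ_x ‖ṽ(x) − v̄‖²_{HS∕n} ≤ (N(N−1)∕2) · (⟨v, Δ_{j+1} v⟩ + Σ_x ‖(δṽ)(x)‖²_{HS∕n})`, every level `j`, every `U(n)` (`d = 4`)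

Lineage `b2b-balaban-t4-ne7-p1` (CRUX PROVER NE7 #1 = OWNER of BINDER row NE7), generation 116; ROAD-G116 §6 (P).  ✓ `NE7EffectiveFormGaugeFixedCoercive.effectiveForm_add_divSq_ge_grad_flat_allLevels`
(effective form + Landau penalty ≥ full gradient energy, constant one) + the box Poincaré inequality for matrix fields ✓ `NE7BoxPoincareMatrix.poincare_periodBox_nhs` (gen 93; constant `m(m+1)∕2` on `[0,m+1)^d`,
box bonds only — a fortiori all bonds).  WHAT ([folklore]; 0 def, 0 sorry):
* `sum_nhsNormSq_sub_mean_le_grad` — torus form of the box Poincaré inequality for the four components of a periodic-box 1-form: `Σ_x Σ_ν nhsNormSq(Y(x)_ν − Ȳ_ν) ≤ (m(m+1)∕2)·Σ_x Σ_μ Σ_ν nhsNormSq(Y(x+e_μ)_ν − Y(x)_ν)`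
  on `periodBox (m+1)` (`Ȳ_ν` the box mean).
* **`effectiveForm_add_divSq_ge_meanZero_flat_allLevels`** (`L ≥ 2`, `0 < ε ≤ ε₀`, `N = m+1 ≥ 1`, every `j`, every `v ∈ skewSub 4 n N`):
  `Σ_{x∈[0,N)^4} Σ_ν nhsNormSq(ṽ(x)_ν − v̄_ν) ≤ (m(m+1)∕2)·(D²(minAct_{j+1} ∘ chart_1)(0)[v, v] + Σ_x nhsNormSq(Σ_μ (ṽ(x)_μ − ṽ(x−e_μ)_μ)))`
  — on the orthogonal complement of the constants (its exact null space modulo gauge, ✓ `NE7EffectiveFormKernelFlatCharacterisation`) the gauge-fixed effective form is bounded below by `2∕(N(N−1))` times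
  the `ℓ²` distance to the constants: a SPECTRAL GAP, uniform in `j` and `n`, of order `N^{−2}` in the volume (massless, as it must be).
* `effectiveForm_ge_meanZero_landau_flat_allLevels` — the Landau-slice version (no penalty term).
HONEST FRAMING: flat datum; volume-dependent gap (no mass); OUR minimisers (B11 (8) with `sfClass`); nothing of Bałaban's asserted; NOT NE7 as a spine node; spine 0∕9; NOT infinite volume, NOT mass gap,
NOT BetaPertH, NOT Clay.
-/

set_option autoImplicit false

open scoped BigOperators Matrix Matrix.Norms.L2Operator Topology
open NormedSpace Finset

namespace Summit.QuantumFields.BalabanUV.T4Continuum.NE7EffectiveFormFlatSpectralGap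

open Literature.MathematicalPhysics.QuantumFieldTheory.Balaban1983to89
open B7Prop1Explicit B7Prop2Explicit
open T4AveragingDeficitWallBoundary (periodBox)
open AveragingDeficitTorusChart (TDir chart chartDir)
open AveragingDeficitTwoLevelPrep (skewSub)
open MinimalActionSandwich (minAct)
open MinimalActionRate (sfClass)
open MinimalActionWitness (flatCfg)
open MatrixNorms (nhsNormSq nhsNormSq_nonneg)
open NE7BoxPoincareMatrix (poincare_periodBox_nhs)
open NE7EffectiveFormGaugeFixedCoercive (effectiveForm_add_divSq_ge_grad_flat_allLevels effectiveForm_ge_grad_landau_flat_allLevels)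

noncomputable section

variable {d : ℕ} {n : Type} [Fintype n] [DecidableEq n]

omit [DecidableEq n] in
/-- **Torus∕box Poincaré for the components of a 1-form** (all bonds of `ℤ^d` from the box, not only the interior ones):
`Σ_{x∈[0,m+1)^d} Σ_ν nhsNormSq (Y(x)_ν − Ȳ_ν) ≤ (m(m+1)∕2) · Σ_x Σ_μ Σ_ν nhsNormSq (Y(x+e_μ)_ν − Y(x)_ν)`, `Ȳ_ν = (m+1)^{−d} Σ_{z ∈ box} Y(z)_ν`. [folklore] -/
theorem sum_nhsNormSq_sub_mean_le_grad [Nonempty n] (m : ℕ) (Y : Site d → Fin d → Matrix n n ℂ) :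
    ∑ x ∈ periodBox (d := d) (m + 1), ∑ ν : Fin d, nhsNormSq (Y x ν - (((m + 1 : ℕ) : ℂ) ^ d)⁻¹ • ∑ z ∈ periodBox (d := d) (m + 1), Y z ν)
      ≤ (m : ℝ) * (m + 1) / 2 * ∑ x ∈ periodBox (d := d) (m + 1), ∑ μ : Fin d, ∑ ν : Fin d, nhsNormSq (Y (x + e μ) ν - Y x ν) := by
  have hC : 0 ≤ (m : ℝ) * (m + 1) / 2 := by positivity
  calc ∑ x ∈ periodBox (d := d) (m + 1), ∑ ν : Fin d, nhsNormSq (Y x ν - (((m + 1 : ℕ) : ℂ) ^ d)⁻¹ • ∑ z ∈ periodBox (d := d) (m + 1), Y z ν)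
      = ∑ ν : Fin d, ∑ x ∈ periodBox (d := d) (m + 1), nhsNormSq (Y x ν - (((m + 1 : ℕ) : ℂ) ^ d)⁻¹ • ∑ z ∈ periodBox (d := d) (m + 1), Y z ν) :=
        Finset.sum_comm
    _ ≤ ∑ ν : Fin d, ((m : ℝ) * (m + 1) / 2 * ∑ x ∈ periodBox (d := d) (m + 1), ∑ μ : Fin d,
          (if x + e μ ∈ periodBox (d := d) (m + 1) then nhsNormSq (Y (x + e μ) ν - Y x ν) else 0)) :=
        Finset.sum_le_sum fun ν _ => poincare_periodBox_nhs m (fun x => Y x ν)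
    _ ≤ ∑ ν : Fin d, ((m : ℝ) * (m + 1) / 2 * ∑ x ∈ periodBox (d := d) (m + 1), ∑ μ : Fin d, nhsNormSq (Y (x + e μ) ν - Y x ν)) := by
        refine Finset.sum_le_sum fun ν _ => mul_le_mul_of_nonneg_left ?_ hC
        refine Finset.sum_le_sum fun x _ => Finset.sum_le_sum fun μ _ => ?_
        split_ifs
        · exact le_rfl
        · exact nhsNormSq_nonneg _
    _ = (m : ℝ) * (m + 1) / 2 * ∑ x ∈ periodBox (d := d) (m + 1), ∑ μ : Fin d, ∑ ν : Fin d, nhsNormSq (Y (x + e μ) ν - Y x ν) := by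
        rw [← Finset.mul_sum]
        congr 1
        rw [Finset.sum_comm]
        exact Finset.sum_congr rfl fun x _ => Finset.sum_comm

/-- **SPECTRAL GAP OF THE GAUGE-FIXED EFFECTIVE FORM ON MEAN-ZERO FIELDS** (`d = 4`, every `U(n)`, `L ≥ 2`): for `0 < ε ≤ ε₀`, every `m` (`N = m+1`), every `j`, every `v ∈ skewSub 4 n (m+1)`,
`Σ_{x∈[0,N)^4} Σ_ν nhsNormSq (ṽ(x)_ν − v̄_ν) ≤ (m(m+1)∕2) · (D²(minAct 4 (sfClass 4 L N ε) L N (j+1) ∘ chart_1)(0)[v, v] + Σ_x nhsNormSq (Σ_μ (ṽ(x)_μ − ṽ(x−e_μ)_μ)))`. [folklore] -/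
theorem effectiveForm_add_divSq_ge_meanZero_flat_allLevels [Nonempty n] {L : ℕ} [NeZero L] (hL : 2 ≤ L) :
    ∃ ε₀ : ℝ, 0 < ε₀ ∧ ∀ ε : ℝ, 0 < ε → ε ≤ ε₀ → ∀ (m : ℕ) (j : ℕ) (v : ↥(skewSub 4 n (m + 1))),
      ∑ x ∈ periodBox (m + 1), ∑ ν : Fin 4,
          nhsNormSq (chartDir (ContinuousLinearMap.id ℝ (Matrix n n ℂ)) (m + 1) (v : TDir 4 n (m + 1)) x ν
            - (((m + 1 : ℕ) : ℂ) ^ 4)⁻¹ • ∑ z ∈ periodBox (m + 1), chartDir (ContinuousLinearMap.id ℝ (Matrix n n ℂ)) (m + 1) (v : TDir 4 n (m + 1)) z ν)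
        ≤ (m : ℝ) * (m + 1) / 2 *
          (fderiv ℝ (fderiv ℝ (fun y : ↥(skewSub 4 n (m + 1)) => minAct 4 (sfClass 4 L (m + 1) ε) L (m + 1) (j + 1)
              (chart (ContinuousLinearMap.id ℝ (Matrix n n ℂ)) (m + 1) (flatCfg : Site 4 → Fin 4 → (Matrix n n ℂ)ˣ) (y : TDir 4 n (m + 1))))) 0 v v
            + ∑ x ∈ periodBox (m + 1), nhsNormSq (∑ μ : Fin 4,
                (chartDir (ContinuousLinearMap.id ℝ (Matrix n n ℂ)) (m + 1) (v : TDir 4 n (m + 1)) x μ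
                  - chartDir (ContinuousLinearMap.id ℝ (Matrix n n ℂ)) (m + 1) (v : TDir 4 n (m + 1)) (x - e μ) μ))) := by
  obtain ⟨ε₀, hε₀, H⟩ := effectiveForm_add_divSq_ge_grad_flat_allLevels (n := n) hL
  refine ⟨ε₀, hε₀, fun ε hε hεle m j v => ?_⟩
  have hC : 0 ≤ (m : ℝ) * (m + 1) / 2 := by positivity
  have h := H ε hε hεle (m + 1) (Nat.succ_pos m) j v
  exact (sum_nhsNormSq_sub_mean_le_grad m _).trans (mul_le_mul_of_nonneg_left h hC)

/-- **Landau-slice spectral gap**: under the coarse Landau condition the effective form ALONE controls the `ℓ²` distance to the constants,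
`Σ_x Σ_ν nhsNormSq (ṽ(x)_ν − v̄_ν) ≤ (m(m+1)∕2) · D²(minAct_{j+1} ∘ chart_1)(0)[v, v]`, every `j`, `n` (`N = m+1`). [folklore] -/
theorem effectiveForm_ge_meanZero_landau_flat_allLevels [Nonempty n] {L : ℕ} [NeZero L] (hL : 2 ≤ L) :
    ∃ ε₀ : ℝ, 0 < ε₀ ∧ ∀ ε : ℝ, 0 < ε → ε ≤ ε₀ → ∀ (m : ℕ) (j : ℕ) (v : ↥(skewSub 4 n (m + 1))),
      (∀ x : Site 4, ∑ μ : Fin 4,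
          (chartDir (ContinuousLinearMap.id ℝ (Matrix n n ℂ)) (m + 1) (v : TDir 4 n (m + 1)) x μ
            - chartDir (ContinuousLinearMap.id ℝ (Matrix n n ℂ)) (m + 1) (v : TDir 4 n (m + 1)) (x - e μ) μ) = 0) →
      ∑ x ∈ periodBox (m + 1), ∑ ν : Fin 4,
          nhsNormSq (chartDir (ContinuousLinearMap.id ℝ (Matrix n n ℂ)) (m + 1) (v : TDir 4 n (m + 1)) x ν
            - (((m + 1 : ℕ) : ℂ) ^ 4)⁻¹ • ∑ z ∈ periodBox (m + 1), chartDir (ContinuousLinearMap.id ℝ (Matrix n n ℂ)) (m + 1) (v : TDir 4 n (m + 1)) z ν)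
        ≤ (m : ℝ) * (m + 1) / 2 *
          fderiv ℝ (fderiv ℝ (fun y : ↥(skewSub 4 n (m + 1)) => minAct 4 (sfClass 4 L (m + 1) ε) L (m + 1) (j + 1)
              (chart (ContinuousLinearMap.id ℝ (Matrix n n ℂ)) (m + 1) (flatCfg : Site 4 → Fin 4 → (Matrix n n ℂ)ˣ) (y : TDir 4 n (m + 1))))) 0 v v := by
  obtain ⟨ε₀, hε₀, H⟩ := effectiveForm_ge_grad_landau_flat_allLevels (n := n) hL
  refine ⟨ε₀, hε₀, fun ε hε hεle m j v hdiv => ?_⟩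
  have hC : 0 ≤ (m : ℝ) * (m + 1) / 2 := by positivity
  have h := H ε hε hεle (m + 1) (Nat.succ_pos m) j v hdiv
  exact (sum_nhsNormSq_sub_mean_le_grad m _).trans (mul_le_mul_of_nonneg_left h hC)

end

end Summit.QuantumFields.BalabanUV.T4Continuum.NE7EffectiveFormFlatSpectralGap
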